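import Literature.MathematicalPhysics.QuantumFieldTheory.Balaban1983to89.T3AvgDivergenceSplit
import Literature.MathematicalPhysics.QuantumFieldTheory.Balaban1983to89.BlockAveragingSectionAction
import HarnessLib

/-!
# `Balaban1983to89.T3SectASteps` — rung R3, crux K1, child «MinimiserStabilityRegPr» (stmt-QuantumFields-19200): [Balaban1985Variational]
# Sect. A (the induction-on-`k` scaffolding of Theorem 1: (11) the datum `V₀` one level up, (12)–(13) the lift of the level-`(k−1)`
# configuration into the level-`k` spaces with `C₁ = L³`, and the `k = 1` sentence «we take simply U₀ = V₀» with (14)) PROVED for the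
# T³ family's pure-small-field carrier — the LQB leaves `B11Thm1.StepA11` (GAPS G-B11-A1), `StepA13` (census C-pv12-2), `BaseK1` (G-B11-A2)
# at `T3Thm1Carrier.varProblem3`, as standalone theorems, via the tree's exact averaging section

Cell `ym3-torus` (HUMAN RULING D-0037, YM ladder rung R3), seat `ym3-torus-p1` gen 7 (UV side); cell record HOME/UV3-NODE.md §16.8.  WHAT THIS IS
NOT: not Theorem 1 (whose content at the carrier is Prop 7-from-(14), Prop 8, Sect. F — LQB's `Prop7From14`/`Prop8Printed`/`SectFPrinted`,
hypothesis schemas); and NOT an instantiation of LQB's packaged induction `B11Thm1.thm1At_allLevels`: that needs the dictionary law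
`B11.VarProblemX.Laws` (iii) («a minimal orbit in 𝔘(e′) ∩ 𝔅(V) lying in 𝔘(e) is minimal in 𝔘(e) ∩ 𝔅(V)» for ALL `e, e′`), which in the
GLOBAL reading R1 of `varProblem3` is, for `e > e′`, exactly the located gap G-K1aR-2 (`InfSixOfEightAt`) — cell finding F-g7-2; so the
d = 3 line consumes `Thm1At` / `Prop7Printed` / `Prop8Printed` at the carrier directly (`T3Thm1Carrier`, `T3ExistSplit`), and the
Sect. A scaffolding is recorded here as THEOREMS about the carrier's objects.

* §1 **`secTo F n K h V`** — an EXPLICIT, threshold-free section of the descent `D_{n,K}`: the `(K−n)`-fold iterated face section of the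
  tree (`BlockAveragingSectionAction.iterSec`, all curvature on one face per block) read through the level identification `fieldShift`;
  PROVED `descendTo_secTo` (`D_{n,K}(secTo V) = V`), `secTo_mem_fibre`, `plaqSmall_secTo` (`PlaqSmall δ V ⇒ PlaqSmall δ (secTo V)`, every
  `δ > 0`: the section keeps the plaquette variables).  ⇒ **(11) PROVED** (`StepA11` at the carrier): a (7)-datum `V` of height `n` has the
  (7)-datum `V₀ := secTo F n (n+1) V` one level up with `D_{n,n+1}V₀ = V` and the same `ε₁`.
* §2 **(13) PROVED** (`StepA13` at the carrier, `C₁ = L³`): `RegPr F (n+1) K e U ⇒ RegPr F n K (L³e) U` for `e ≥ 0` (`regPr_height_succ`: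
  the plaquette threshold gains `L² ≤ L³`, the divergence radius exactly `L³` — LQB's `ineq13_plaquette_factor`/`ineq13_bond_factor`
  arithmetic at objects), and `U ∈ regFibrePr F (n+1) K _ e (secTo F n (n+1) _ V) ⇒ U ∈ regFibrePr F n K _ (L³e) V` (`mem_regFibrePr_height_succ`,
  the descent tower `T3DescentFibreTower.descendTo_descendTo`).
* §3 **THE `k = 1` SENTENCE WITH (14) PROVED** (`BaseK1` at the carrier, for `B₃ > 4`, `LB₃ ≥ 1`): for `0 < ε₁` and `PlaqSmall ε₁ V`,
  `secTo F n (n+1) _ V ∈ regFibrePr F n (n+1) _ (L³B₃ε₁) V` (`secTo_mem_regFibrePr_base`; plaquettes `< ε₁ ≤ LB₃ε₁ = L³B₃ε₁·L^{−2}`,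
  divergence `≤ 4ε₁ < B₃ε₁ = L³B₃ε₁·L^{−3}` by `T3AvgDivergenceSplit.divSmall_of_plaqSmall`).  More generally `secTo_mem_regFibrePr_of`:
  print's regular fibre (6)(ε₀) of run `K` over a (7)-datum is NONEMPTY as soon as `ε₁ ≤ ε₀L^{−2(K−n)}` and `4ε₁ < ε₀L^{−3(K−n)}` (small `K − n`
  only — for general `K − n` non-emptiness of (6)(ε₀) is part of the located gap G-K1aR-2′ `T3ExistSplit.MinSixAttainedAt`, i.e. of Thm 1's
  induction itself).

References: T. Bałaban, CMP 102 (1985) 277–309 [Balaban1985Variational] (Sect. A (11)–(14) pp.279–280); CMP 109 (1987) 249–301 [Balaban1987RG1]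
((0.4)/(0.11) p.253).
-/

noncomputable section

open MeasureTheory Filter Topology
open scoped Matrix.Norms.L2Operator
open Literature.MathematicalPhysics.QuantumFieldTheory.Balaban1983to89.T3ContinuumYM3Torus
open Literature.MathematicalPhysics.QuantumFieldTheory.Balaban1983to89.T3LevelShift
open Literature.MathematicalPhysics.QuantumFieldTheory.Balaban1983to89.T3UnitLawDensityEML (ℰp measurableE_ℰp)
open Literature.MathematicalPhysics.QuantumFieldTheory.Balaban1983to89.T3UnitScaleTilt
open Literature.MathematicalPhysics.QuantumFieldTheory.Balaban1983to89.T3TiltDescent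
open Literature.MathematicalPhysics.QuantumFieldTheory.Balaban1983to89.T3CruxEstimates
open Literature.MathematicalPhysics.QuantumFieldTheory.Balaban1983to89.T3ConstrainedMinimiser
open Literature.MathematicalPhysics.QuantumFieldTheory.Balaban1983to89.T3DescentFibreTower
open Literature.MathematicalPhysics.QuantumFieldTheory.Balaban1983to89.T3RegularMinimiser
open Literature.MathematicalPhysics.QuantumFieldTheory.Balaban1983to89.T3PrintedRegularMinimiser
open Literature.MathematicalPhysics.QuantumFieldTheory.Balaban1983to89.T3PrintedMinimiserExistence
open Literature.MathematicalPhysics.QuantumFieldTheory.Balaban1983to89.T3LowerAlongMinimisersSplit (L_cast_pos scale_pos_le_one)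
open Literature.MathematicalPhysics.QuantumFieldTheory.Balaban1983to89.T3AvgDivergenceSplit (divSmall_of_plaqSmall)
open Literature.MathematicalPhysics.QuantumFieldTheory.Balaban1983to89.BlockAveragingSectionAction (iterSec iter_iterSec plaqSmall_iterSec)
open Literature.MathematicalPhysics.QuantumFieldTheory.Balaban1983to89.Missing

namespace Literature.MathematicalPhysics.QuantumFieldTheory.Balaban1983to89.T3SectASteps

/-! ## §1 The explicit section of the descent and (11) -/

section Section

variable (F : T3Family) {G : Type*} [GaugeGroup G] (ℰ : LoopAverage G)

/-- **AN EXPLICIT SECTION OF `D_{n,K}`**: the `(K−n)`-fold iterated face section of the tree on the `K`-th tower applied to `V` read as the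
height-`(K−n)` field of that tower (threshold-free; independent of the small-loop average). [cite: Balaban1987RG1, (0.11) p.253] -/
def secTo (n K : ℕ) (h : n ≤ K) (V : GaugeField (F.P n) 0 G) : GaugeField (F.P K) 0 G :=
  iterSec (P := F.PP F.m K) (K - n)
    (fieldShift (F.sitesPerDir_eq (m := F.m) (K := K) (j := K - n) (m' := F.m) (K' := n) (j' := 0) (by omega)) V)

/-- **`D_{n,K}(secTo V) = V`** for every small-loop average with `ℰ(1,…,1) = 1` (`iter_iterSec` + the level identification).
[cite: Balaban1987RG1, (0.11) p.253] -/
theorem descendTo_secTo (hE : ∀ n : ℕ, ℰ.E (fun _ : Fin (n + 1) => (1 : G)) = 1) {n K : ℕ} (h : n ≤ K)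
    (V : GaugeField (F.P n) 0 G) : descendTo F ℰ n K h (secTo F n K h V) = V := by
  have hk : K - n ≤ (F.PP F.m K).m + (F.PP F.m K).K := by show K - n ≤ F.m + K; omega
  show fieldShift _ (Averaging.iter (fun i => BlockAveraging.blockAvg (P := F.PP F.m K) (j := i) ℰ) (K - n)
    (iterSec (P := F.PP F.m K) (K - n) (fieldShift _ V))) = V
  rw [iter_iterSec ℰ hE (K - n) hk, fieldShift_fieldShift]
  exact fieldShift_refl _ _

/-- Hence `secTo V` lies in the fibre of `V`. [cite: Balaban1985Variational, (3) p.278] -/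
theorem secTo_mem_fibre (hE : ∀ n : ℕ, ℰ.E (fun _ : Fin (n + 1) => (1 : G)) = 1) {n K : ℕ} (h : n ≤ K)
    (V : GaugeField (F.P n) 0 G) : secTo F n K h V ∈ fibre F ℰ n K h V :=
  (mem_fibre_iff F ℰ).mpr (descendTo_secTo F ℰ hE h V)

/-- **THE SECTION KEEPS THE PLAQUETTE VARIABLES SMALL**: `PlaqSmall δ V ⇒ PlaqSmall δ (secTo V)` for every `δ > 0` (the face section's
plaquettes are those of `V` or trivial). [cite: Balaban1985Variational, (7) p.278] -/
theorem plaqSmall_secTo {n K : ℕ} (h : n ≤ K) {δ : ℝ} (hδ : 0 < δ) {V : GaugeField (F.P n) 0 G} (hV : PlaqSmall δ V) :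
    PlaqSmall δ (secTo F n K h V) := by
  have hk : K - n ≤ (F.PP F.m K).m + (F.PP F.m K).K := by show K - n ≤ F.m + K; omega
  refine plaqSmall_iterSec (P := F.PP F.m K) hδ (K - n) hk _ (fun p => ?_)
  rw [plaqHol_fieldShift]
  exact hV _

/-- **(11) PROVED for the pure-small-field carrier** (LQB leaf `StepA11` at objects): a (7)-datum `V` of the `n`-th approximation (`PlaqSmall
ε₁ V`, `ε₁ > 0`) has a (7)-datum `V₀ := secTo F n (n+1) V` one level up with the SAME `ε₁` and `D_{n,n+1}V₀ = V` — print: «We can easily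
construct a configuration V₀ on 𝔅′_{k−1} such that it satisfies (7) on 𝔅′_{k−1}, and … V̄₀ = V on Λ_k. (11)». [cite: Balaban1985Variational, (11) p.279] -/
theorem stepA11 (hE : ∀ n : ℕ, ℰ.E (fun _ : Fin (n + 1) => (1 : G)) = 1) (n : ℕ) {ε₁ : ℝ} (hε₁ : 0 < ε₁)
    {V : GaugeField (F.P n) 0 G} (hV : PlaqSmall ε₁ V) :
    PlaqSmall ε₁ (secTo F n (n + 1) (Nat.le_succ n) V) ∧ descendTo F ℰ n (n + 1) (Nat.le_succ n) (secTo F n (n + 1) (Nat.le_succ n) V) = V :=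
  ⟨plaqSmall_secTo F (Nat.le_succ n) hε₁ hV, descendTo_secTo F ℰ hE (Nat.le_succ n) V⟩

end Section

/-! ## §2 (12)–(13): one comparison level down costs the factor `C₁ = L³` -/

section Thirteen

variable (F : T3Family)

/-- **(13) PROVED, regularity part** (LQB leaf `StepA13` at objects): printed-regularity of run `K` relative to the height `n + 1` at radius
`e ≥ 0` implies printed-regularity relative to the height `n` at radius `L³e` — the plaquette threshold `eL^{−2(K−n−1)} = L²·eL^{−2(K−n)} ≤
L³eL^{−2(K−n)}`, the divergence radius `eL^{−3(K−n−1)} = L³eL^{−3(K−n)}` («from the form (2) of the regularity conditions, it follows that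
U₀ ∈ 𝔘_k({Ω_j}, B₃L³ε₁)»). [cite: Balaban1985Variational, (13) p.280] -/
theorem regPr_height_succ {n K : ℕ} (hnK : n + 1 ≤ K) {e : ℝ} (he : 0 ≤ e)
    {U : GaugeField (F.P K) 0 (Matrix.specialUnitaryGroup (Fin 2) ℂ)} (hU : RegPr F (n + 1) K e U) :
    RegPr F n K ((F.L : ℝ) ^ 3 * e) U := by
  have hL : (0 : ℝ) < F.L := L_cast_pos F
  have hL1 : (1 : ℝ) ≤ F.L := by exact_mod_cast F.hL.2.le
  have hxL : ((F.L : ℝ)⁻¹) * F.L = 1 := inv_mul_cancel₀ hL.ne'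
  refine ⟨plaqSmall_of_le ?_ hU.1, fun b => (hU.2 b).trans_le (le_of_eq ?_)⟩
  · -- `e·x^{2(K−n−1)} ≤ L³e·x^{2(K−n)}`
    unfold regThreshold
    have h2 : ((F.L : ℝ)⁻¹) ^ (2 * (K - (n + 1))) = (F.L : ℝ) ^ 2 * ((F.L : ℝ)⁻¹) ^ (2 * (K - n)) := by
      rw [show 2 * (K - n) = 2 * (K - (n + 1)) + 2 by omega, pow_add]
      field_simp
    rw [h2]
    have hx : 0 ≤ ((F.L : ℝ)⁻¹) ^ (2 * (K - n)) := (scale_pos_le_one F _).1.le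
    have hL23 : (F.L : ℝ) ^ 2 ≤ (F.L : ℝ) ^ 3 := pow_le_pow_right₀ hL1 (by norm_num)
    nlinarith [mul_le_mul_of_nonneg_left (mul_le_mul_of_nonneg_right hL23 he) hx]
  · -- `e·x^{3(K−n−1)} = L³e·x^{3(K−n)}`
    rw [show 3 * (K - n) = 3 * (K - (n + 1)) + 3 by omega, pow_add]
    field_simp

/-- **(13) PROVED, with the constraint** (`StepA13` at objects): a configuration of run `K` which is printed-regular at radius `e ≥ 0` relative
to the height `n + 1` and lies in the fibre of `V₀ = secTo F n (n+1) V` lies in print's regular fibre of run `K` over `V` at radius `L³e`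
(descent tower: `D_{n,K}U = D_{n,n+1}(D_{n+1,K}U) = D_{n,n+1}V₀ = V`). [cite: Balaban1985Variational, (12)-(13) p.280] -/
theorem mem_regFibrePr_height_succ {n K : ℕ} (hnK : n + 1 ≤ K) {e : ℝ} (he : 0 ≤ e)
    {V : GaugeField (F.P n) 0 (Matrix.specialUnitaryGroup (Fin 2) ℂ)} {U : GaugeField (F.P K) 0 (Matrix.specialUnitaryGroup (Fin 2) ℂ)}
    (hU : U ∈ regFibrePr F (n + 1) K hnK e (secTo F n (n + 1) (Nat.le_succ n) V)) :
    U ∈ regFibrePr F n K ((Nat.le_succ n).trans hnK) ((F.L : ℝ) ^ 3 * e) V := by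
  obtain ⟨hfib, hreg⟩ := (mem_regFibrePr_iff F).mp hU
  refine (mem_regFibrePr_iff F).mpr ⟨?_, regPr_height_succ F hnK he hreg⟩
  exact mem_fibre_trans F ℰp (Nat.le_succ n) hnK hfib (secTo_mem_fibre F ℰp expMeanLogSU_E_one (Nat.le_succ n) V)

end Thirteen

/-! ## §3 The `k = 1` sentence with (14), and non-emptiness of (6)(ε₀) for short descents -/

section Base

variable (F : T3Family)

/-- **THE SECTION LIES IN PRINT'S REGULAR FIBRE WHEN THE THRESHOLDS ALLOW** (`ε₁ > 0`, `PlaqSmall ε₁ V`, `ε₁ ≤ ε₀L^{−2(K−n)}`, `4ε₁ <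
ε₀L^{−3(K−n)}`): `secTo F n K V ∈ regFibrePr F n K _ ε₀ V` — in particular print's space (6)(ε₀) over `V` is NONEMPTY for such short descents
(plaquettes kept, divergence by `T3AvgDivergenceSplit.divSmall_of_plaqSmall`). [cite: Balaban1985Variational, (6)-(7) p.278] -/
theorem secTo_mem_regFibrePr_of {n K : ℕ} (h : n ≤ K) {ε₁ ε₀ : ℝ} (hε₁ : 0 < ε₁)
    (hpl : ε₁ ≤ regThreshold F n K ε₀) (hdiv : 4 * ε₁ < ε₀ * ((F.L : ℝ)⁻¹) ^ (3 * (K - n)))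
    {V : GaugeField (F.P n) 0 (Matrix.specialUnitaryGroup (Fin 2) ℂ)} (hV : PlaqSmall ε₁ V) :
    secTo F n K h V ∈ regFibrePr F n K h ε₀ V := by
  have hsmall : PlaqSmall ε₁ (secTo F n K h V) := plaqSmall_secTo F h hε₁ hV
  exact (mem_regFibrePr_iff F).mpr ⟨secTo_mem_fibre F ℰp expMeanLogSU_E_one h V,
    plaqSmall_of_le hpl hsmall, divSmall_of_plaqSmall F hsmall hdiv⟩

/-- **THE `k = 1` SENTENCE WITH (14) PROVED for the pure-small-field carrier** (LQB leaf `BaseK1` at objects, `C₁ = L³`; `B₃ > 4`, `LB₃ ≥ 1`):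
for `0 < ε₁` and a (7)-datum `V` (`PlaqSmall ε₁ V`), `U₀ := V₀ = secTo F n (n+1) V` lies in print's regular fibre of run `n + 1` over `V` at
radius `L³B₃ε₁` — «for k = 1 we do not have any solutions of the variational problem yet, and then we take simply U₀ = V₀», «The configuration
U₀ constructed above satisfies (14) with C₁ = L³» (plaquettes `< ε₁ ≤ LB₃ε₁`; divergence `≤ 4ε₁ < B₃ε₁`). [cite: Balaban1985Variational, (14) p.280] -/
theorem secTo_mem_regFibrePr_base (n : ℕ) {B₃ ε₁ : ℝ} (hB₃ : 4 < B₃) (hε₁ : 0 < ε₁)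
    {V : GaugeField (F.P n) 0 (Matrix.specialUnitaryGroup (Fin 2) ℂ)} (hV : PlaqSmall ε₁ V) :
    secTo F n (n + 1) (Nat.le_succ n) V ∈ regFibrePr F n (n + 1) (Nat.le_succ n) ((F.L : ℝ) ^ 3 * B₃ * ε₁) V := by
  have hL : (0 : ℝ) < F.L := L_cast_pos F
  have hL1 : (1 : ℝ) ≤ F.L := by exact_mod_cast F.hL.2.le
  have hk : n + 1 - n = 1 := by omega
  refine secTo_mem_regFibrePr_of F (Nat.le_succ n) hε₁ ?_ ?_ hV
  · -- `ε₁ ≤ L³B₃ε₁·L^{−2} = LB₃ε₁`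
    unfold regThreshold
    rw [hk, show ((F.L : ℝ)⁻¹) ^ (2 * 1) = ((F.L : ℝ) ^ 2)⁻¹ by rw [Nat.mul_one, inv_pow],
      show (F.L : ℝ) ^ 3 * B₃ * ε₁ * ((F.L : ℝ) ^ 2)⁻¹ = (F.L * B₃) * ε₁ by field_simp]
    have : 1 ≤ (F.L : ℝ) * B₃ := by nlinarith
    nlinarith
  · -- `4ε₁ < L³B₃ε₁·L^{−3} = B₃ε₁`
    rw [hk, show ((F.L : ℝ)⁻¹) ^ (3 * 1) = ((F.L : ℝ) ^ 3)⁻¹ by rw [Nat.mul_one, inv_pow],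
      show (F.L : ℝ) ^ 3 * B₃ * ε₁ * ((F.L : ℝ) ^ 3)⁻¹ = B₃ * ε₁ by field_simp]
    nlinarith

/-- **(14) IN THE CARRIER's VOCABULARY** (`B11Thm1.VarProblemA.Sat14` with `Near` read as fibre membership): at `k = 1` the background `U₀ =
V₀` is printed-regular at radius `L³B₃ε₁` AND averages to `V`. [cite: Balaban1985Variational, (14) p.280] -/
theorem sat14_base (n : ℕ) {B₃ ε₁ : ℝ} (hB₃ : 4 < B₃) (hε₁ : 0 < ε₁)
    {V : GaugeField (F.P n) 0 (Matrix.specialUnitaryGroup (Fin 2) ℂ)} (hV : PlaqSmall ε₁ V) :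
    RegPr F n (n + 1) ((F.L : ℝ) ^ 3 * B₃ * ε₁) (secTo F n (n + 1) (Nat.le_succ n) V) ∧
      secTo F n (n + 1) (Nat.le_succ n) V ∈ fibre F ℰp n (n + 1) (Nat.le_succ n) V := by
  have h := (mem_regFibrePr_iff F).mp (secTo_mem_regFibrePr_base F n hB₃ hε₁ hV)
  exact ⟨h.2, h.1⟩

end Base

end Literature.MathematicalPhysics.QuantumFieldTheory.Balaban1983to89.T3SectASteps

end
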